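import Literature.NumberTheory.EllipticCurves.Kobayashi2003.SignedColemanKatoZeta
import Literature.NumberTheory.EllipticCurves.KuriharaNumber
import Literature.NumberTheory.EllipticCurves.KatoKolyvaginPrimes
import Literature.NumberTheory.EllipticCurves.PAdicHeights
import HarnessLib

/-!
# Kim–Kim–Sun 2020, Thm. 1.1 (any ODD good prime, in particular `p = 3`) AT THE TRIVIAL CHARACTER: a UNIT
# Kurihara number of `E` gives KATO'S MAIN CONJECTURE for `T_pE` over the cyclotomic `ℤ_p`-extension `ℚ_∞`
# — read on the pinned objects of Kobayashi's `η = 1` Coleman/Kato package (named fact; nothing asserted)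

Topic `NumberTheory/EllipticCurves`, sub-directory `KimKimSun2020` (namespace = path,
`Literature.NumberTheory.EllipticCurves.KimKimSun2020`). ONE named fact (`def … : Prop`, D-0014) and nothing
else: no definition with computational content, no instance, no notation, no `_holds` (size XL: Kato's Euler
system and its explicit reciprocity law mod `λ`, Mazur–Rubin Kolyvagin systems over `Λ`, Büyükboduk's
`Λ`-adic rigidity — none of it is in Mathlib). It is the ODD-PRIME twin of the accepted
`Kim2026/KatoMainIdentityOfUnitKuriharaNumber.lean` (`Kim2026.thm111_katoMainIdentity_of_kuriharaNumber_ne_zero`,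
p607903, which reads C.-H. Kim, Amer. J. Math. 148 (2026) Thm. 1.11 — printed for `p ≥ 5` only) and exists for
ONE reason: the earlier three-author paper PRINTS the same implication «unit Kurihara number ⟹ Kato's IMC» for
every prime `p > 2`, so it reaches `p = 3`, where Kim 2026 (`p ≥ 5`) and Castella–Sano 2026 (`p > 3`) are
silent. Written for the cell `bsd-ssimc` (HOME `run/shared/lean/pub/bsd-ssimc/`; the programme assembles BSD
for analytic rank ≤ 1 STRICTLY from published theorems and TYPES the remainder — nothing here proves BSD),
seat `bsd-line-slh-p1` (lead gen 2), route `SignedLowerHalves`, crux item stmt-BirchSwinnertonDyer-19001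
`KobayashiLowerHalfLargeImage`, line `kurihara_rigidity`, residue stub `stub_three` (`p = 3`). Consumer
(kernel, Summits-side): `Theorems/SignedLowerHalvesKobayashiLowerHalfLargeImageKuriharaRigidityThm74Odd.lean`
(`KuriharaRigidity.kobayashiMainConjecture_of_katoMainConjectureFrame_odd`: this fact + Kobayashi Thm. 1.2 +
the period unit at `p ≥ 5` AND at `p = 3` ⟹ `KobayashiMainConjecture W p ε` for BOTH signs, Kobayashi's Thm.
7.4 (ii) run in the kernel at every odd `p`), which is to DISCHARGE the Kobayashi half of the composite binder
`KimKimSun2020_thm11_via_kobayashi74_three` (`Summits/…/Rank1Residual/Supersingular/KobayashiMainConjectureKuriharaRigidityThree.lean`,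
p611880).

## The printed statements (C.-H. Kim, M. Kim, H.-S. Sun, *On the indivisibility of derived Kato's Euler
systems and the main conjecture for modular forms*, Selecta Math. (N.S.) 26 (2020), Paper No. 31 =
arXiv:1709.05780; held text `paper:arxiv-1709.05780`, page files `pNNNN.txt`)

* §1.2.1 (p0003 L39–L41): "Let `p > 2` be a prime. Let `f = ∑_n a_n(f) qⁿ ∈ S₂(Γ₁(N), ψ)` be a newform with
  character `ψ` and assume `(N,p) = 1`." (again §2, p0008 L5: "Let `p` be a prime `> 2`.") p0004 L1–L9:
  "`ℚ_∞` the cyclotomic `ℤ_p`-extension of `ℚ` … `n` a square-free product of Kolyvagin primes … `[a/n]⁺_f :=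
  (1/2Ω⁺_f)·(∫_{a/n}^{i∞} f(z)dz + ∫_{−a/n}^{i∞} f(z)dz) ∈ ℤ_{f,λ}` … where … `Ω⁺_f` is the `(+)`-part of an
  integral canonical period of `f` defined in §5.4 … for each `ℓ` we fix a primitive root mod `ℓ` and define
  `log_{𝔽_ℓ}(a)` … its image mod `p`."
* **Theorem 1.1 (Main Theorem)** (p0004 L11–L31), VERBATIM up to symbols lost in the held text: "Assume the
  following conditions: (NA) `a_p(f) ≢ 1 (mod λ)` and `a_p(f) ≢ ψ(p) (mod λ)`; (Im) the image of `ρ̄` contains a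
  conjugate of `SL₂(𝔽_p)`; (Tam) for a prime `q`, • [first clause], • `ord_q(N(ρ̄)) = ord_q(N)` otherwise. If
  `δ̃_n := ∑_{a ∈ (ℤ/nℤ)ˣ} (\overline{[a/n]⁺_f} · ∏_{ℓ∣n} \overline{log_{𝔽_ℓ}(a)}) ≠ 0 ∈ 𝔽_λ` for some `n`, then •
  the derived Kato's Euler system does not vanish modulo `λ`, and • the Iwasawa main conjecture à la Kato
  (Conjecture 3.3) holds for `(f, ℚ_∞/ℚ)`." (p0004 L40–L43): "Condition (Tam) is a necessary but very mild
  condition. The first condition of Condition (Tam) corresponds to the following divisibility criterion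
  `p ∤ (∏_{q∣N_sp}(q−1))·(∏_{q∣N_ns}(q+1))` where `N_sp := ∏_{q∥N, a_q(f)=1} q` and `N_ns := ∏_{q∥N, a_q(f)=−1} q`.
  Indeed, if we have `δ̃_n ≠ 0` for some `n`, then the second condition of Condition (Tam) is automatic (Remark
  2.3)." Remark 2.3 (p0009 L32–L37): "The first condition removes the discrepancy coming from the difference
  of the valuations between `N`-primitive and `N`-imprimitive `L`-values. The second condition removes all the
  Tamagawa defect … If the second condition is violated … the corresponding Euler system cannot produce a
  primitive Kolyvagin system". §3.3.1 (p0011): "`ℍ^i(T_f(1)) := lim←_n H^i_ét(Spec 𝒪_{ℚ_n}[1/p], j_{n,*}T_f(1))`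
  … `ℍ¹(T_f(1)) ≅ H¹(ℚ_∞, T_f(1))` … Let `𝐳_Kato ∈ ℍ¹(T_f(1))` be Kato's `p`-adic zeta element …
  **Conjecture 3.3.** `char_Λ(ℍ¹(T_f(1))/Λ𝐳_Kato) = char_Λ(ℍ²(T_f(1)))`" with Prop. 3.4 (same characteristic
  ideal for the finite-index `Λκ₁^∞ ⊆ Λ𝐳_Kato`) and Remark 3.5 (canonical choice of the zeta element). §8.2.2
  (p0022 L78–L85), the authors' own `p = 3` GOOD SUPERSINGULAR example: "`E`: `y² = x³ − 67x + 926` with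
  conductor `760 = 2³·5·19` … the residual representation is surjective, `a₃(E) = 3 (≠ 0)`, `a₅(E) = 1`,
  `a₁₉(E) = −1`, and `L(E,1)/Ω⁺_E = 2`. Since `3 ∤ (5−1)·(19+1) = 80` and `δ̃₁ ∈ 𝔽₃ˣ`, Kato's main conjecture
  for `E` with `p = 3` holds." — which FIXES the reading of (Tam)'s first clause for an elliptic curve: at the
  primes `q ∥ N` (multiplicative), `p ∤ q − 1` at the split ones (`a_q = 1`), `p ∤ q + 1` at the non-split
  ones (`a_q = −1`); additive primes (`2³` there) impose nothing in the first clause.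
* S. Kobayashi, Invent. Math. 152 (2003) (held copy `paper:doi-10-1007-s00222-002-0265-4`), `p` an ODD prime of
  good supersingular reduction, `a_p = 0`: §5 p. 10 "**Kato's main conjecture.** `Char(𝐇²(T)^η) =
  Char(𝐇¹(T)^η/Z(T)^η)`", Thm. 5.2 iv) / Remark 5.3 i), Prop. 7.1 ii) (p. 12: "`𝐇²(T)` is isomorphic to
  `X⁰(E/K_∞)`"), proof of Thm. 7.4 (p. 13). K. Kato, Astérisque 295 (2004) §12.2, Thm. 12.4–12.6 (`Z ⊂ Z(f,T)`
  of FINITE index, under (12.5.2) = the image of `G_ℚ → Aut T_pE` contains `SL₂(ℤ_p)`), Conj. 12.10 (p. 224).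
  The tree's `η = 1` package `Kobayashi2003.SignedColemanKatoData W p f ϖ κ γ ε I` (file
  `Kobayashi2003/SignedColemanKatoZeta`, fact `thm62_63_73_signedColemanKato_zeta`, `p ≠ 2`) pins exactly these
  objects on `ℚ_∞`: `I.H = 𝐇¹_Γ(T_pW)` (= KKS's `ℍ¹(T_f(1))` for `f = f_W`, `T_f(1) ≅ T_pW` under (Im)),
  `d.Z` = Kato's Thm. 12.6 submodule projected to the `Δ`-trivial component, and every
  `Y : W.FineSelmerDualData κ γ` is a dual datum of `Sel₀(ℚ_∞, E[p^∞])` (= `X⁰(E/K_∞)^Δ ≅ 𝐇²(T)^Δ`).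

## The fact below and its reading (weaker than print, never stronger; flags for the referee)

Frame = that of the package fact `Kobayashi2003.thm62_63_73_signedColemanKato_zeta` (`W/ℚ` globally minimal
with the structure facts of `T_pW` as instance BINDERS; `p ≠ 2` good with `a_p = 0`; a newform `f` of `W` at
any level; the period ratio `ϖ`, `ϖ·Ω(W) = Ω⁺_f`; the cyclotomic `κ` with generator `γ` matching the
cyclotomic variable) AND the hypotheses of Thm. 1.1 for `f := f_W` at `p`, transcribed: `(N,p) = 1` as good
reduction at `p`; (NA) is AUTOMATIC (`a_p = 0 ≢ 1`, `ψ = 1` so `ψ(p) = 1`) given the frame's `a_p = 0`, which is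
displayed; (Im) as `ρ̄_{W,p}` onto (`HasSurjectiveModNGaloisRep p`), which implies it; (Tam)'s FIRST clause,
verbatim in the elliptic-curve reading fixed by §8.2.2: at every prime `q` of multiplicative reduction,
`p ∤ q − 1` if split (`HasSplitMultiplicativeReductionAtPrime q`), `p ∤ q + 1` if not; (Tam)'s SECOND clause is
NOT displayed — the source states it automatic under the certificate (p. 4 L43, Remark 2.3) —; Kim–Kim–Sun's
canonical-period normalisation as the period-transfer clause `Ω(W) = u·Ω⁺_f`, `u ∈ ℚ`, `|u|_p = 1` (reading
`KKS20-can-period` below). EXTRA hypothesis (weaker than print; flag `KKS20-tower`): the whole tower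
`ρ̄_{W,pⁿ}` onto for all `n` — Kato's (12.5.2), which mod-`p` surjectivity alone does not give at `p = 3`
(Serre/Elkies); on the good supersingular classes it is a THEOREM from `ρ̄_{W,p}` onto (Wuthrich 2014 Lemma 20,
tree `GoodSS.towerSurj_of_surj`), so consumers discharge it. The CERTIFICATE: a level `n ∈ 𝒩₁`
(`Kato.IsKolyvaginProduct W p 1 n`) all of whose primes carry the cyclicity flag `#W̃(𝔽_ℓ)[p] ≤ p` (as in EVERY
sibling — weaker fact; flag `Kim2026-(6)-cyclic-reading`), surjective discrete logarithms
`ψ_ℓ : (ℤ/ℓ)ˣ ↠ ℤ/p`, and `kuriharaNumber f (p^1) n ψ ≠ 0`. CONCLUSION — Conjecture 3.3, Kato's main conjecture,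
read on the package EXACTLY as the Kim sibling reads Kim's (3): for every sign `ε` and all pinned
`I : Kato2004.IwasawaH1Data W p κ γ`, `Y : W.FineSelmerDualData κ γ` there is a package datum
`d : Kobayashi2003.SignedColemanKatoData W p f ϖ κ γ ε I` whose zeta submodule ALSO satisfies
`Module.charIdeal Λ Y.X = Module.charIdeal Λ (I.H ⧸ d.Z)`.

READING FLAGS. `KKS20@3-MR-H4` (the tree's EXISTING flag, `Summits/…/Rank1Residual/Supersingular/SharpFlatKuriharaRoute.lean`
and `X8KimLargeImageOPEN.lean`; DISPLAYED here, not resolved): KKS Lemma 4.3 ("Condition (Im) implies all the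
conditions of Assumption 4.2", citing [mazur-rubin-book]) includes Mazur–Rubin's (H.4) «`Hom_{𝔽_λ[G_ℚ]}(T̄, T̄^*(1))
= 0` or `p > 4`», which FAILS for the self-dual `E[3]`; Mazur–Rubin use `p > 4` only to choose useful primes,
and at `p = 3` that step is supplied by R. Sakamoto (Doc. Math. 27 (2022) App. A in the rank-`0` setting;
J. Théor. Nombres Bordeaux 36 (2024) 919–946, Kolyvagin systems at `p = 3`); the fact records Thm. 1.1 AS
PRINTED («`p > 2`») and every consumer displays it as a hypothesis. `KKS20-eta1-zeta-line` (twin of the Kim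
sibling's `Kim26-111-eta1-zeta-line`): KKS's Conjecture 3.3 is about the line `Λ𝐳_Kato ⊂ ℍ¹(T_f(1)) = I.H`; it is
READ on the package's `d.Z` (Kato's Thm. 12.6 finite-index submodule, `Δ`-trivial component) — characteristic
ideals of the torsion quotients are blind to the finite index (their own Prop. 3.4 is the same remark for
`Λκ₁^∞ ⊆ Λ𝐳_Kato`); `ℍ²` is read as `Sel₀^∨` (Kobayashi Prop. 7.1 ii) / Kurihara), the reading `KR-IMC-forms` of
the Summits-side binder file. `KKS20-eta1-package`: the datum `d` is existential (package construction =
Kobayashi Thm. 6.2/6.3/7.3 i) + Kato 12.6 at `η = 1`, the content of `thm62_63_73_signedColemanKato_zeta`, which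
carries `p ≠ 2` only). `KKS20-can-period`: KKS normalise `[a/n]⁺` by Vatsal's integral canonical period
`Ω^{can,+}_f` (§5.4: "By [wiles] with Condition (Im) … and `(N,p)=1`, the Hecke module `H₁(X₁(N), ℤ_p)^±_𝔪` is
free of rank one over `𝕋_𝔪`"); for the newform of an elliptic curve with (Im) and the period transfer
`Ω(W) = u·Ω⁺_f`, `|u|_p = 1`, these normalisations are `p`-adic units apart (the source's own §8.2.2 reads `δ̃₁`
off `L(E,1)/Ω⁺_E`; the Kim sibling's `KR-period`), so `kuriharaNumber f p n ψ ≠ 0` ⟺ `δ̃_n ≠ 0`; reading, not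
formalised. `KKS20-Tam1-reading`: split/non-split ⟺ `a_q = ±1` (Silverman AEC VII.5). Everything recorded is
implied by, never stronger than, the print under these readings; nothing asserted.

What this fact is NOT: not Kurihara's conjecture (no claim that a unit Kurihara number exists — the line's
open statement at `3`); not the converse; not Kobayashi's signed main conjecture (derived Summits-side from
this fact by the kernel Thm. 7.4 at odd `p`); not a statement for anomalous `a_p` ((NA) is displayed as
`a_p = 0`), nor at a bad `p`; silent wherever no unit Kurihara number exists (Tamagawa defect, Remark 2.3).

## References

* C.-H. Kim, M. Kim, H.-S. Sun, Selecta Math. (N.S.) 26 (2020), Paper No. 31 = arXiv:1709.05780: §1.2.1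
  (PDF p. 3), Thm. 1.1 with (Tam) and the divisibility criterion (PDF p. 4), Remark 2.3 (PDF p. 9), Conj. 3.3,
  Prop. 3.4, Remark 3.5 (PDF p. 11), Assumption 4.2 / Lemma 4.3 / Lemma 4.5 (PDF p. 12), §5.4 (PDF p. 16),
  §8.2.2 (PDF p. 22). [KimKimSun2020]
* S. Kobayashi, Invent. Math. 152 (2003) 1–36: §5 (p. 10), Thm. 5.2 iv), Remark 5.3 i), Prop. 7.1 ii)
  (p. 12), proof of Thm. 7.4 (p. 13). [Kobayashi2003]
* K. Kato, Astérisque 295 (2004): §12.2, Thm. 12.4–12.6, (12.5.2), Conj. 12.10 (pp. 220–224). [Kato2004Asterisque]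
* B. Mazur, K. Rubin, *Kolyvagin systems*, Mem. AMS 799 (2004), §3.5 (H.4), Thm. 5.3.10. [MazurRubin2004]
* R. Sakamoto, Doc. Math. 27 (2022), App. A (`p = 3`). [Sakamoto2022pSelmer]
* C. Wuthrich, Doc. Math. 19 (2014), Lemma 20. [Wuthrich2014]
* C.-H. Kim, Amer. J. Math. 148 (2026), Thm. 1.11, §1.3.5 (the `p ≥ 5` sibling). [Kim2022StructureSelmer]
-/

noncomputable section

open scoped Classical MatrixGroups ModularForm

open CongruenceSubgroup WeierstrassCurve Field Literature.NumberTheory.EllipticCurves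
  Literature.NumberTheory.EllipticCurves.ModularForms Literature.NumberTheory.GaloisRepresentations

namespace Literature.NumberTheory.EllipticCurves.KimKimSun2020

/-- **Kim–Kim–Sun 2020, Thm. 1.1 at an ODD good prime with `a_p = 0` — a UNIT Kurihara number of `E` at a
cyclic level gives KATO'S MAIN IDENTITY `char_Λ(ℍ¹(T)/Λ𝐳_Kato) = char_Λ(ℍ²(T))` (their statement 3.3),
read on the pinned objects of Kobayashi's `η = 1` Coleman/Kato package** (Selecta Math. (N.S.) 26 (2020) =
arXiv:1709.05780, Thm. 1.1 (PDF p. 4; standing «Let `p > 2` be a prime», p. 3), the divisibility criterion for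
(Tam)'s first clause and «the second condition of (Tam) is automatic» given `δ̃_n ≠ 0` (p. 4), Remark 2.3,
statement 3.3 / Prop. 3.4 (p. 11), §8.2.2 (p. 22: their own `p = 3` good supersingular example, fixing the reading of
(Tam) on an elliptic curve); S. Kobayashi, Invent. Math. 152 (2003) §5, Prop. 7.1 ii); K. Kato, Astérisque 295
(2004) Thm. 12.4–12.6, §12.10). Frame of `Kobayashi2003.thm62_63_73_signedColemanKato_zeta` (`W/ℚ` globally
minimal, structure facts of `T_pW` as instance binders, `p ≠ 2` good with `a_p = 0` — so (NA) is automatic —,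
newform `f` of `W`, period ratio `ϖ` with `ϖ·Ω(W) = Ω⁺_f`, cyclotomic `κ`, generator `γ` matching the variable)
and Thm. 1.1's hypotheses for `f := f_W`: (Im) as `ρ̄_{W,p}` onto; the whole tower `ρ̄_{W,pⁿ}` onto (EXTRA, flag
`KKS20-tower`: Kato's (12.5.2); a theorem on the supersingular classes); (Tam)'s first clause (`p ∤ q − 1` at
split, `p ∤ q + 1` at non-split multiplicative primes `q`); the canonical-period normalisation as the period
transfer `Ω(W) = u·Ω⁺_f`, `|u|_p = 1` (flag `KKS20-can-period`); the certificate: `n ∈ 𝒩₁`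
(`Kato.IsKolyvaginProduct W p 1 n`) with the cyclicity flag `#W̃(𝔽_ℓ)[p] ≤ p` at its primes, surjective
`ψ_ℓ : (ℤ/ℓ)ˣ ↠ ℤ/p`, `kuriharaNumber f (p^1) n ψ ≠ 0`. CONCLUSION: for every sign `ε`, every pinned
`I : Kato2004.IwasawaH1Data W p κ γ` («`ℍ¹(T_pW)`») and `Y : W.FineSelmerDualData κ γ` («`Sel₀(ℚ_∞, W[p^∞])^∨`,
same characteristic ideal as `ℍ²`) there is a package datum `d` (Kobayashi Thm. 6.2/6.3/7.3 i) + Kato 12.6 at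
`η = 1`) with `Module.charIdeal Λ Y.X = Module.charIdeal Λ (I.H ⧸ d.Z)`. READING FLAGS (module docstring):
`KKS20@3-MR-H4` (DISPLAYED: at `p = 3` Lemma 4.3's appeal to Mazur–Rubin needs Sakamoto's `p = 3` choice of
useful primes), `KKS20-eta1-zeta-line`, `KKS20-eta1-package`, `KKS20-can-period`, `KKS20-Tam1-reading`,
cyclicity flag. Weaker than print, nothing asserted, no `_holds` (size XL); silent when no unit Kurihara
number exists (Tamagawa defect, Remark 2.3). At `p ≥ 5` the sibling Kim fact is the better-hypothesised source;
this fact exists for `p = 3`.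
[cite: KimKimSun2020, Thm. 1.1 (PDF p. 4), §1.2.1 (PDF p. 3), (Tam) divisibility criterion and second clause automatic (PDF p. 4), Remark 2.3 (PDF p. 9), statement 3.3 and Prop. 3.4 (PDF p. 11), Lemma 4.3 (PDF p. 12), §5.4 (PDF p. 16), §8.2.2 (PDF p. 22)]
[cite: Kobayashi2003, §5 (p. 10), Thm. 5.2 iv) and Remark 5.3 i) (pp. 9–10), Prop. 7.1 ii) (p. 12), proof of Thm. 7.4 (p. 13)]
[cite: Kato2004Asterisque, §12.2 (p. 220), Thm. 12.4–12.6 and (12.5.2) (pp. 221–222), §12.10 (p. 224)]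
[cite: MazurRubin2004, §3.5 hypothesis (H.4) and Thm. 5.3.10] [cite: Sakamoto2022pSelmer, App. A]
[cite: Wuthrich2014, Lemma 20 (p. 399)] -/
def thm11_katoMainIdentity_of_kuriharaNumber_ne_zero : Prop :=
  ∀ (W : WeierstrassCurve ℚ) [W.IsElliptic] [W.IsGloballyMinimal] (p : ℕ) [Fact p.Prime]
    [ContinuousSMul ℤ_[p] (W.tateModule p)] [Module.Free ℤ_[p] (W.tateModule p)]
    [Module.Finite ℤ_[p] (W.tateModule p)]
    {N : ℕ} [NeZero N] (f : CuspForm (Gamma0 N) 2) (ϖ : ℚ)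
    (κ : ZpExtension ℚ p) (γ : absoluteGaloisGroup ℚ),
  -- the frame of Kobayashi's `η = 1` package, at an odd good prime with `a_p = 0` ((NA) automatic)
    p ≠ 2 → W.HasGoodReductionAtPrime p → W.frobeniusTrace p = 0 → IsNewformOf W f →
    (ϖ : ℝ) * W.realPeriodRat = plusPeriod f →
    κ.IsCyclotomic → κ.IsTopGenerator γ → IsCyclotomicVariable p γ →
  -- (Im), and the full tower (flag `KKS20-tower`)
    W.HasSurjectiveModNGaloisRep p → (∀ n : ℕ, W.HasSurjectiveModNGaloisRep (p ^ n : ℕ)) →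
  -- (Tam), first clause: `p ∤ q − 1` at split, `p ∤ q + 1` at non-split multiplicative primes `q`
    (∀ (q : ℕ) [Fact q.Prime], W.HasMultiplicativeReductionAtPrime q →
      (W.HasSplitMultiplicativeReductionAtPrime q → ¬ p ∣ q - 1) ∧
      (¬ W.HasSplitMultiplicativeReductionAtPrime q → ¬ p ∣ q + 1)) →
  -- the canonical-period normalisation as the period transfer (flag `KKS20-can-period`)
    (∃ u : ℚ, ‖(u : ℚ_[p])‖ = 1 ∧ W.realPeriodRat = u * plusPeriod f) →
  -- the certificate: a unit Kurihara number at a cyclic level `n ∈ 𝒩₁`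
  ∀ (n : ℕ) [NeZero n], Kato.IsKolyvaginProduct W p 1 n →
    (∀ (ℓ : ℕ) [Fact ℓ.Prime], ℓ ∣ n →
      Nat.card {P : ((WeierstrassCurve.integralModelInt W).map
          (Int.castRingHom (ZMod ℓ))).toAffine.Point // p • P = 0} ≤ p) →
  ∀ ψ : (ℓ : ℕ) → (ZMod ℓ)ˣ →* Multiplicative (ZMod (p ^ 1)),
    (∀ ℓ ∈ n.primeFactors, Function.Surjective (ψ ℓ)) →
    kuriharaNumber f (p ^ 1) n ψ ≠ 0 →
  -- statement 3.3: Kato's main identity, read on the pinned objects through the `η = 1` package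
  ∀ (ε : ℤˣ) (I : Kato2004.IwasawaH1Data W p κ γ) (Y : W.FineSelmerDualData κ γ),
    ∃ d : Kobayashi2003.SignedColemanKatoData W p f ϖ κ γ ε I,
      Module.charIdeal (IwasawaAlgebra p) Y.X =
        Module.charIdeal (IwasawaAlgebra p) (I.H ⧸ d.Z)

end Literature.NumberTheory.EllipticCurves.KimKimSun2020

end
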